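import Mathlib
import HarnessLib
import HarnessLib.Audit
import Summits.ValiantsHypothesis.Statement
import Literature.Computability.AlgebraicComplexity.StandardFamilies
import Literature.Computability.AlgebraicComplexity.ValiantConjectureProofs
import Summits.ValiantsHypothesis.ValiantsHypothesis.Theorems.GeneratorObstructionsPerPowTraceQP
import HarnessLib.Audit.Status.Attr

/-!
Route: SchenstedIndex

DORMANT since 2026-08-29T19:44:07Z (census g0: costume|duplicate of —; reader census-reader-27-g0) — unstaffed, not closed; items shared with open routes are served there. `ledger route dormant <id> --off` reactivates.

# Route SchenstedIndex — Cayley–Hamilton writes the equations of VBP-bar — per's 1-factorisation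
indicators are not band-limited under the n^cyc kernel

It suffices to show X = OneFactorisationBandLimit (spine card ch-schensted-one-factorisation, its
crux K1 "separation growth", typed at
the slot level). Work in the UNPADDED homogeneous model: X_n(m) := closure of {tr A(x)^m : A an n×n
matrix of linear forms in the m²
variables x} (width-n trace powers; VBP-complete up to polynomial factors). Fix the torus sector w =
t·J_m, i.e. the bipartite multigraph
t·K_{m,m} with tm² edge SLOTS S = Fin t × Fin m × Fin m, and let SP(t,m) be the set partitions of S
into blocks of size m. X says: for every
c and m₀ there is m ≥ max(m₀,1) such that for every width n = m+e in the quasi-polynomial window n ≤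
2^((log₂ m + c)^c) some multiplicity t
has the 0/1 indicator 1_OF of the 1-FACTORISATIONS of t·K_{m,m} (partitions all of whose blocks have
m distinct rows and m distinct columns)
OUTSIDE span_n(t,m) := the ℂ-span of the functions π ↦ ∏_{B∈π} C_B(X), C_B(X) = Σ_{q : ℤ/m ≃ B} ∏_i
X(q i, q (i+1)) (= m × the
Hamiltonian-cycle polynomial of the principal block X[B]), X over tm²×tm² complex matrices of rank ≤
n. By the card's Theorem A
(Schur–Weyl + Procesi–Razmyslov) X is EQUIVALENT to "the border trace-power complexity of per_m is
not quasi-polynomially bounded" (border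
homogeneous Valiant, stronger than VH); only the REPRESENTATION form of its easy direction is
load-bearing for `closes` (item PowTraceCertificate: a K1 witness t forbids
any exact width-(m+e) power-trace representation tr(A^m) = per_m; 2026-08-16 cone repair,
superseding the orbit-closure form SectorCertificate).
Lean: `∀ c m₀ : ℕ, ∃ m : ℕ, m₀ ≤ m ∧ 1 ≤ m ∧ ∀ e : ℕ, m + e ≤ 2 ^ ((Nat.log 2 m + c) ^ c) → ∃ t : ℕ,
(fun π : {π : Finpartition (Finset.univ : Finset (Fin t × Fin m × Fin m)) // ∀ B ∈ π.parts, B.card =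
m} => if (∀ B ∈ π.1.parts, (B.image fun s => s.2.1).card = m ∧ (B.image fun s => s.2.2).card = m)
then (1 : ℂ) else 0) ∉ Submodule.span ℂ (Set.range fun X : {X : Matrix (Fin t × Fin m × Fin m) (Fin
t × Fin m × Fin m) ℂ // X.rank ≤ m + e} => fun π : {π : Finpartition (Finset.univ : Finset (Fin t ×
Fin m × Fin m)) // ∀ B ∈ π.parts, B.card = m} => ∏ B ∈ π.1.parts, ∑ q : Fin m ≃ ↥B, ∏ i : Fin m, X.1
(q i).1 (q (finRotate m i)).1)`

## Assembly
Pure logic on the two CRUXES (certified sorry-free, crux-only `closes` in glue.lean = Sketch.lean;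
2026-08-16 cone repair): suppose VP ℂ = VNP ℂ;
then perFamily ℂ ∈ VP ℂ (perFamily_mem_VNP_holds), so (per_n) is a VP family
(mem_VP_ofFintype_iff_holds); the LANDED theorem
Summit.ValiantsHypothesis.ValiantsHypothesis.Theorems.perPowTraceQP_proof (VP ⇒ quasi-polynomial
power-trace representations of per_m; the
proved item stmt-ValiantsHypothesis-11661 of route GeneratorObstructions, whose import cone is
clean) gives c and, for every m ≥ 1, some e with m+e
in the window and an (m+e)×(m+e) matrix A of homogeneous linear forms with tr(A^m) = per_m;
OneFactorisationBandLimit at (c, 0) gives m ≥ 1 and,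
for that e, a t with 1_OF ∉ span_(m+e)(t,m); PowTraceCertificate says that then no such A exists —
contradiction. Hence VP ℂ ≠ VNP ℂ =
`ValiantsHypothesis`: `closes : OneFactorisationBandLimit → PowTraceCertificate →
ValiantsHypothesis`. The one bookkeeping fact (PerPowTraceQP) is
DISCHARGED inside the proof (the route file imports
Summits.ValiantsHypothesis.ValiantsHypothesis.Theorems.GeneratorObstructionsPerPowTraceQP), never
assumed. GIP17 Prop. 5 in point form (Theorems.GeneratorObstructions.powTraceMembership_proof:
representation ⇒ orbit-closure membership) is NO LONGER
used or imported: its module sits on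
Literature.Barriers.ValiantsHypothesis.GCTMatrixPowering{Cor9,Proofs,} →
Literature.Barriers.PneNP.GCTOccurrenceObstructions,
whose catalogued-but-never-provable named Props (GIP2017_prop20 in its original erratum'd form,
Pow/IMM/OccurrenceObstructionConjecture) made the
route's import cone unstaffable; the representation form of the certificate makes that step
unnecessary (imports dropped: PowerTraceStabilizer,
OrbitClosure, Theorems.GeneratorObstructionsPowTraceMembership).

Rationale: WHY THIS LINE. Mechanism (card ch-schensted-one-factorisation, critic grade new-mechanism):
ℂ[X_n(m)] is the subalgebra of the trace ring of m² generic
n×n matrices generated by symmetrised length-m trace words, so by the second fundamental theorem of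
matrix invariants (Procesi1976,
Razmyslov1974) the ideal of this VBP-closure is the Cayley–Hamilton trace T-ideal — completely
known, unlike the ideals of Det_n or IMM-bar
("no strong equations vanishing on the orbit closure of IMM have been found so far",
arXiv:2311.17019 §1; closure out of reach in
arXiv:1611.00827 §2.2). Per torus sector a degree-(tm) equation is a function a on SP(t,m); it takes
at per_m the value Σ_{F ∈ OF} a_F
(the Latin-square / 1-factorisation evaluation of arXiv:1511.02927, Kumar2015) and, dually through
the kernel K_n(π,π') = Σ_{σ∼π,σ'∼π'}
n^cyc(σ⁻¹σ'), per_m escapes no sector equation at width n iff 1_OF ∈ span_n — a band-limit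
(longest-decreasing-subsequence ≤ n, Schensted1961)
statement about one explicit 0/1 vector. Imported areas: invariant theory of matrices (FFT/SFT,
trace identities), RSK/Schensted and
symmetric-group ideals ⊕_{ℓ(λ)>n} I_λ, 1-factorisation asymptotics of regular bipartite multigraphs
(Schrijver / van der Waerden). WHY
EASIER than the equivalent border statement: each instance (m,n,t) is finite linear algebra with an
explicit integer kernel; membership is
monotone in n and in t with ONE cofinal sequence t·J_m; dual certificates are explicit equations
whose existence in per-visible types is
forced wherever a plethysm multiplicity exceeds a sum of symmetric Kronecker coefficients (foreseen
crux K2), i.e. part of the problem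
becomes representation-theoretic inequalities with stable-range asymptotics; a degree floor (span_n
= everything once n ≥ tm) is proved;
per enters only through 1-factorisation counts. What prior routes do not do: GeneratorObstructions
(same unpadded tr X^m model) compares
generation degrees 𝔪/𝔪² of covariant algebras whose ideals stay unknown; GCTMult / IntegralGCT /
ValuativeGCT / BorderApolarity live in the
PADDED det model and meet padding no-go's and Kronecker positivity; UnpaddedGIT has Mumford
existence but no generator of the ideal. The
negatives index (UlrichPadded, Elusive, GrenetRigidity ×2) is disjoint from this model.

RANKED CRUXES. #2 OneFactorisationBandLimit (crux) — K1 of the card (separation growth, slot-level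
form): for every c, m₀ there is m ≥ max(m₀,1) such that for every e with m+e ≤ 2^((log₂ m + c)^c)
there is t with 1_OF(t,m) ∉ span_(m+e)(t,m) — the 1-factorisation indicator of t·K_(m,m) on m-block
partitions of its tm² edge slots is not in the span of the block-cycle vectors of rank ≤ m+e
matrices. [difficulty: open-problem] (why it might fail: per_m may have quasi-polynomial BORDER
trace-power complexity (strictly weaker than VP-membership, so consistent with VH); and no handle
may exist: per-visible types (ℓ(λ) ≤ m²) may carry no dimension-forced equations once n ≥ m+2,
leaving only position arguments (card K2/K3).) [arXiv:1611.00827, arXiv:2311.17019, Procesi1976,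
Razmyslov1974, Schensted1961, arXiv:1511.02927]
#3 PowTraceCertificate (crux) — the sector certificate in REPRESENTATION form (2026-08-16 cone
repair; supersedes the orbit-closure form SectorCertificate, which it weakens: old form + GIP17
Prop. 5 ⇒ new form): for m ≥ 1 and all e, t, if 1_OF(t,m) ∉ span_(m+e)(t,m) then NO (m+e)×(m+e)
matrix A of homogeneous linear forms in the m² variables has tr(A^m) = per_m. Plan (elementary — no
orbit closure, no topology, no polarisation): finite-dimensional duality gives a ⊥ span_(m+e)(t,m)
with ⟨a,1_OF⟩ ≠ 0; E_a(F) := Σ_π a_π μ_π ∏_(B∈π) coeff(F, α_B) (α_B = multiset of (row,col) labels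
of B, μ_π = ∏ parallel-label multiplicities!); write A = Σ x_ij M_ij and split every M_ij into its n
= m+e rows (rank-one pieces); multilinear expansion gives the EXACT identity E_a(tr A^m) = Σ_(r : S
→ Fin n) ⟨a, v_(X_r)⟩ with X_r(s,s') = (M_(label s))_(r s, r s') a slot matrix of rank ≤ n, so
E_a(tr A^m) = 0, while coeff(per_m, x^α) = 1 exactly on permutation graphs gives E_a(per_m) = ⟨a,
1_OF⟩ ≠ 0. Identity and per-evaluation verified in exact arithmetic this session for (t,m,n) ∈
{(1,2,1),(1,2,2),(2,2,2),(1,3,1),(1,3,2)} (sanity/span_check.py). [difficulty: M] (why it might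
fail: only via the encoding — parallel-slot multiplicities μ_π, the finRotate cycle convention,
coefficient extraction of tr(A^m); the identity was checked exactly only for m ≤ 3, n ≤ 2 — a typing
slip is repairable by restating.) [arXiv:1611.00827, arXiv:1511.02927, Kumar2015, Procesi1976,
MulmuleySohoni2001]
DISCHARGED FACT (not an item): VP ⇒ quasi-polynomial power-trace representations — if (per_n) is a
VP family then per_m = tr(A^m) for an (m+e)×(m+e) matrix of linear forms with m+e ≤ 2^((log₂ m +
c)^c), one c for all m ≥ 1 — is the PROVED item stmt-ValiantsHypothesis-11661 of route
GeneratorObstructions (Summit.ValiantsHypothesis.ValiantsHypothesis.Theorems.perPowTraceQP_proof)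
[Burgisser2000, Valiant1979, IkenmeyerLandsberg2017]; `closes` imports that Theorems file (clean
cone: 65 project modules, no Literature.Barriers.*) and invokes it; nothing but the two cruxes is
assumed. RETIRED 2026-08-16 (cone repair): GIP17 Prop. 5 in point form (proved item
stmt-ValiantsHypothesis-11660, Theorems.GeneratorObstructions.powTraceMembership_proof) and the
orbit-closure certificate SectorCertificate (stmt-ValiantsHypothesis-16082, dropped) — the Prop. 5
module imports the GCTMatrixPowering / PneNP.GCTOccurrenceObstructions barrier files whose
conjecture-Props can never be discharged, and the representation form needs neither.
#9 BorderPcPerThree (support) — special case / calibration rung (card K4): for some t the indicator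
1_OF(t,3) is not in span_3(t,3) — by PowTraceCertificate pc(per_3) ≥ 4 for exact representations
(and, running the same functional E_a through GIP17 Prop. 5 / Zariski closure, border pc(per_3) ≥ 4)
(known: ≥ 3 by 5-minors in sector J_3+2I; truth ≤ 7 = Grenet width via block-cyclic embedding;
dc(per_3) = 7, AlperBogartVelasco2017). Certifiable by exact linear algebra per t (orbit-reduced kit
job, #SP(2·J_3) ≈ 1.9·10⁸); this session checked the encoding: n_*(J_2) = n_*(2J_2) = 2 and
span_2(J_3) = everything, span_1(J_3) ∌ 1_OF (sanity/span_check.py). [difficulty: L]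
[AlperBogartVelasco2017, arXiv:1611.00827, BurgisserIkenmeyer2017]

TWO-LAYER PLAN. Foreseen glued splits (filed informally right after open, typed later):
OneFactorisationBandLimit ⇐ ForcedPerVisibleEquations (K2: some
d, λ ⊢ dm with ℓ(λ) ≤ m² and plethysm multiplicity a_λ(d,m) = ⟨Ind_(S_m≀S_d)^(S_dm) 1, χ^λ⟩
exceeding sm(λ,n) = Σ_(ℓ(μ)≤n) sk(λ,μ) in the
window) → PositionBeyondMultiplicity (K3: where a_λ ≤ sm, P_λ 1_OF meets Ξ ∩ I_(>n), via
autocorrelation character sums of 1-factorisation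
sets) → OneFactorisationBandLimit; PowTraceCertificate ⇐ DualWitness (1_OF ∉ span ⇒ some a ⊥
span_(m+e)(t,m) has ⟨a,1_OF⟩ ≠ 0; finite-dimensional
duality) → ExpansionIdentity (E_a(tr A^m) = Σ_r ⟨a, v_(X_r)⟩ = 0 and E_a(per_m) = ⟨a,1_OF⟩) →
PowTraceCertificate. BorderPcPerThree is the calibration rung for both.

KILL CRITERIA. A proof that 1_OF(t,m) ∈ span_(m^c)(t,m) for all t and all large m (border
trace-power complexity of per polynomial/quasi-polynomial) refutes
OneFactorisationBandLimit: close `refuted:OneFactorisationBandLimit` (and record that border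
homogeneous Valiant fails at that scale — news in
itself). PowTraceCertificate refuted ⇒ class misstated (encoding): repair with the corrected span /
functional (new item, re-certified glue), never drop.
GenFlipThesis (route GeneratorObstructions) or DetqpThesis (route DetQP) proved elsewhere moots the
route (same conclusion, different lever);
a theorem "per-visible types never carry forced equations for n ≥ m+2" kills the K2 branch only
(pivot to K3 position arguments).

NOT DECOMPOSED YET. K2 (dimension-forced equations in per-visible types), K3 (position beyond
multiplicity), K4 (character-table calibration at m = 3, d ≤ 8) of
the card are NOT typed at open: they need the tree's plethysmCoeff / kroneckerCoeff conventions
checked against GIP17's t_(λ,n) ≤ sm(λ,n)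
(symmetric vs full Kronecker) — filed as informal statement items after open, signatures set by me
or a grounder. The converse direction
(completeness of sector certificates for the CLOSURE = Procesi–Razmyslov SFT, the "=" in Theorem A)
and the orbit-closure form of the
certificate (former item SectorCertificate = PowTraceCertificate + GIP17 Prop. 5) are informational
for why K1 is the right target, not items. No padding, no det_n, no multiplicity items.

CHEAPEST FALSIFIER. Encoding first (re-run this session in exact arithmetic, sanity/span_check.py
with the route's literal definitions): n_*(J_2) = n_*(2J_2) = 2 = pc(per_2)
(1_OF ∉ span_1, ∈ span_2; #SP(2J_2) = 105) and span_1(J_3) ∌ 1_OF — PASSED, matching the card; the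
expansion identity behind PowTraceCertificate
(E_a(tr A^m) = Σ_r ⟨a, v_(X_r)⟩, E_a(per_m) = ⟨a,1_OF⟩) PASSED exactly at (t,m,n) ∈
{(1,2,1),(1,2,2),(2,2,2),(1,3,1),(1,3,2)}. Next cheapest: a refuter
re-derives that identity at m = 2 by hand; then the kit job of BorderPcPerThree at t = 2 (membership
of 1_OF(2J_3) in span_3: ≈1.9·10⁸ partitions,
310-ish orbit types after symmetry) — membership for every small t would be evidence that K1's
growth starts late (not a refutation: ∃ t).

NUMBERS. pc(per_2) = n_*(J_2) = 2; border pc(per_3) ∈ [3, 7], dc(per_3) = 7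
(AlperBogartVelasco2017); degree floor: span_n(t·J_m) = everything once
n ≥ tm (card, proved), so witnesses need t > n/m; generically forced equations need d = tm ≳
n^(2+2/(m−1)) (card's count); #SP(J_3) = 280,

DEFINITION REQUESTS. None blocking (everything is inline over Mathlib: Finpartition, Equiv,
finRotate, Matrix.rank, Submodule.span). Nice-to-have Literature
notions to shorten the signatures (card D1): oneFactorisationIndicator, blockCycleVector /
cycleKernel K_n, schenstedIndex n_*,
borderPowComplexity; cite fact wanted for the converse direction only: Procesi–Razmyslov SFT
(multilinear trace identities of M_n(ℂ) in
degree D = ⊕_(ℓ(λ)>n) I_λ ⊂ ℂ[S_D]) — Procesi1976 Thm 4.3 / Razmyslov1974.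

Novelty: Searches (2026-08-16): `lit frontier ValiantsHypothesis --since 2023` (30 rows: nearest
arXiv:2311.17019 DGIJL24 homogeneous formulas, arXiv:2601.09343 symmetric classes, arXiv:2606.08363
Kronecker×IMM — none on closure ideals of trace-power/IMM models); `lit search --source s2 "abc
conjecture arithmetic circuit lower bounds"` (5, irrelevant), `--source s2/openalex` further queries
rate-limited (429), `--source arxiv "fixed polynomial circuit lower bound VNP"` (0); `lit galaxy
search "does not have arithmetic circuits of size" --star all` (0); local searchd down all session
(connection reset ×3); grep of the 63 route files and 136 summit cards for
Schensted|Procesi|Razmyslov|1-factori|trace identit (only the spine card; GeneratorObstructions /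
IntegralOrbits / HartogsRankTwo cite Procesi for degree bounds, trace rings of constants, ASL — not
closure ideals); the spine card's own searches of 2026-08-15 (galaxy pdf/all on IMM polynomial,
occurrence obstructions, Razmyslov, trace identities; crossref GCT matrix powering ≥ 2016; reads of
arXiv:1611.00827 and arXiv:2311.17019).
Nearest prior art found: arXiv:1611.00827 (GIP17 §2.2 Prop 5 / Cor 6 / Thm 10: the unpadded per_m vs
tr X^m model, ORBIT occurrence obstructions only, closure left open); arXiv:2311.17019 (states that
no strong equations for IMM-bar are known); Procesi1976 / Razmyslov1974 (the SFT, never pointed at a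
VBP closure); arXiv:1511.02927 and Kumar2015 (Latin-square evaluations of fundamental invariants at
per/det  [refs: 2311.17019, 2601.09343, 2606.08363, 1611.00827, 1511.02927, Procesi1976, Razmyslov1974, Kumar2015]

Barriers (technique_class: trace-identities, homogeneous-gct-closure, schensted-index): - technique_class: trace-identities, homogeneous-gct-closure, schensted-index
- Literature.Barriers.ValiantsHypothesis.GCTMatrixPowering: GIP17 Thm 10 kills ORBIT occurrence
obstructions in this very model (weights absent from ℂ[GL]^Stab); the certificates here are
arbitrary CLOSURE equations (occurrence ⊂ multiplicity ⊂ ideal position), outside the class by GIP's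
own delimitation; no stabiliser is used.
- Literature.Barriers.ValiantsHypothesis.GCTOccurrenceObstructions: N/A in letter (no padding, no
det_n; membership 1_OF ∈ span_n is an exact linear condition, not a cone/saturation one); conceded
in spirit inside the foreseen K2 (Kronecker-type coefficients).
- Literature.Barriers.ValiantsHypothesis.GCTUsefulModules: same — unpadded model, equations rather
than useful-module occurrences.
- Literature.Barriers.ValiantsHypothesis.NotViaSaturations: N/A (no saturation / semigroup argument;
exact membership).
- Literature.Barriers.ValiantsHypothesis.KroneckerPlethysmHardness: it does not evade it; the bet is
that n_*(t·J_m) is governed by stable-range structure (hook filter, Baik–Deift–Johansson asymptotics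
of lds) rather than by individual NP-hard Kronecker/plethysm positivity instances — the concession
lives in the foreseen K2 (a_λ(d,m) vs sm(λ,n)); K1 itself needs no positivity decision.
- Literature.Barriers.ValiantsHypothesis.AlgebraicNaturalProofs: the certificates E_a are explicit
elements of Sym^d(Sym^m V) of degree ≥ n+1; their VP-constructibility (FSV's conditional bar

History (route lifecycle, newest last):
- 2026-08-16T16:30:50Z · rev 1: restated Assembly (stmt-ValiantsHypothesis-16086) — route-repair glue.non-crux-hypothesis: crux-only deciding theorem `closes : OneFactorisationBandLimit → SectorCertificate → ValiantsHypothesis`; the two bookkee (planner-rbadge-ValiantsHypothesis-SchenstedInd-ed88d22b-0)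
- 2026-08-16T16:30:50Z · rev 1: dropped PowTraceMembership, PerPowTraceQP — route-repair glue.non-crux-hypothesis: crux-only deciding theorem `closes : OneFactorisationBandLimit → SectorCertificate → ValiantsHypothesis`; the two bookkee (planner-rbadge-ValiantsHypothesis-SchenstedInd-ed88d22b-0)
- 2026-08-16T17:03:57Z · rev 3: restated Assembly (stmt-ValiantsHypothesis-16285) — cone repair step 2/2 (route-repair, repair_kind=cone): `closes : OneFactorisationBandLimit → PowTraceCertificate → ValiantsHypothesis` now rests on the proved P (planner-rrepair-ValiantsHypothesis-SchenstedIn-ed88d22b-0)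
- 2026-08-16T17:03:57Z · rev 3: dropped SectorCertificate — cone repair step 2/2 (route-repair, repair_kind=cone): `closes : OneFactorisationBandLimit → PowTraceCertificate → ValiantsHypothesis` now rests on the proved P (planner-rrepair-ValiantsHypothesis-SchenstedIn-ed88d22b-0)
- 2026-08-23T14:34:38Z · DORMANT — reconciler: no traction for 6.1 d (last activity item-evidence-added at 2026-08-17T11:46:12Z); parked, not closed — `ledger route dormant route-ValiantsHypothes (operator:999:917501)
- 2026-08-26T04:26:41Z · REACTIVATED — reconciler: reactivated — activity statement-closed at 2026-08-26T02:34:32Z after parking at 2026-08-23T14:34:38Z (operator:999:2771210)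
- 2026-08-29T19:44:07Z · DORMANT — census g0: costume|duplicate of —; reader census-reader-27-g0 (operator:999:1845702)

sub-problem: ValiantsHypothesis · status: dormant · opened planner-plan-novel-ValiantsHypothesis-ValiantsH-5b693ca4-v2-0 2026-08-16T16:18:54Z · rev 3 · ledger route-ValiantsHypothesis-SchenstedIndex
GENERATED by the gate from the ledger (D-0016/17). Provers cite these decls: `theorem foo : Summit.ValiantsHypothesis.ValiantsHypothesis.Theses.SchenstedIndex.<Decl> := …` in Summits/ValiantsHypothesis/ValiantsHypothesis/Theorems/<Name>.lean.
-/

namespace Summit.ValiantsHypothesis.ValiantsHypothesis.Theses.SchenstedIndex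

open scoped BigOperators Topology Manifold Classical MeasureTheory ProbabilityTheory Matrix InnerProductSpace ComplexConjugate ContinuousMap
open Filter Set Function TopologicalSpace MeasureTheory

attribute [summit_statement] _root_.ValiantsHypothesis

open Literature.PNP

/-- item stmt-ValiantsHypothesis-16081 · crux · rank 2 · open · by planner
why it might fail: per_m may have quasi-polynomial BORDER trace-power complexity (strictly weaker than VP-membership, so consistent with VH); and no handle may exist: per-visible types (ℓ(λ) ≤ m²) may carry no dimension-forced equations once n ≥ m+2, leaving only position arguments (card K2/K3).
sources: arXiv:1611.00827, arXiv:2311.17019, Procesi1976, Razmyslov1974, Schensted1961, arXiv:1511.02927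
[crux] K1 of the card (separation growth, slot-level form): for every c, m₀ there is m ≥ max(m₀,1)
such that for every e with m+e ≤ 2^((log₂ m + c)^c) there is t with 1_OF(t,m) ∉ span_(m+e)(t,m) —
the 1-factorisation indicator of t·K_(m,m) on m-block partitions of its tm² edge slots is not in the
span of the block-cycle vectors of rank ≤ m+e matrices. [difficulty: open-problem] -/
@[route_item "route-ValiantsHypothesis-SchenstedIndex", crux]
def OneFactorisationBandLimit : Prop :=
  ∀ c m₀ : ℕ, ∃ m : ℕ, m₀ ≤ m ∧ 1 ≤ m ∧ ∀ e : ℕ, m + e ≤ 2 ^ ((Nat.log 2 m + c) ^ c) → ∃ t : ℕ, (fun π : {π : Finpartition (Finset.univ : Finset (Fin t × Fin m × Fin m)) // ∀ B ∈ π.parts, B.card = m} => if (∀ B ∈ π.1.parts, (B.image fun s => s.2.1).card = m ∧ (B.image fun s => s.2.2).card = m) then (1 : ℂ) else 0) ∉ Submodule.span ℂ (Set.range fun X : {X : Matrix (Fin t × Fin m × Fin m) (Fin t × Fin m × Fin m) ℂ // X.rank ≤ m + e} => fun π : {π : Finpartition (Finset.univ : Finset (Fin t × Fin m × Fin m)) //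 ∀ B ∈ π.parts, B.card = m} => ∏ B ∈ π.1.parts, ∑ q : Fin m ≃ ↥B, ∏ i : Fin m, X.1 (q i).1 (q (finRotate m i)).1)

/-- item stmt-ValiantsHypothesis-15995 · crux · rank 3 · closed · proved by Summit.ValiantsHypothesis.ValiantsHypothesis.Theorems.SchenstedIndex.powTraceCertificate_proof (prover) · by planner
why it might fail: Only via the encoding: parallel-slot multiplicities μ_π, the finRotate cycle convention, coefficient extraction of tr(A^m) over ℂ; the expansion identity E_a(tr A^m) = Σ_r ⟨a, v_X_r⟩ was checked exactly only for m ≤ 3, n ≤ 2 — a typing slip would be repairable by restating.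
sources: arXiv:1611.00827, arXiv:1511.02927, Kumar2015, Procesi1976, MulmuleySohoni2001
[crux] sector certificate, REPRESENTATION form (2026-08-16 cone repair; supersedes the orbit-closure
form SectorCertificate): for m ≥ 1 and all e, t — if the 1-factorisation indicator 1_OF(t,m) is not
in span_(m+e)(t,m), then NO (m+e)×(m+e) matrix A of homogeneous linear forms in the m² variables has
tr(A^m) = per_m. Plan (elementary; no orbit closure, no topology): finite-dimensional duality gives
a ⊥ span_(m+e)(t,m) with ⟨a, 1_OF⟩ ≠ 0; put E_a(F) := Σ_π a_π μ_π ∏_(B∈π) coeff(F, α_B) (α_B =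
multiset of (row, col) labels of the block B, μ_π = ∏ parallel-label multiplicities!); write A =
Σ_(ij) x_ij M_ij and split each M_ij into its n = m+e rows (rank-one pieces); multilinear expansion
of tr(M_w) over the pieces gives the EXACT identity E_a(tr A^m) = Σ_(r : S → Fin n) ⟨a, v_(X_r)⟩
with X_r(s,s') = (M_(label s))_(r s, r s'), a slot matrix of rank ≤ n, hence E_a(tr A^m) = 0; while
coeff(per_m, x^α) = 1 exactly when α is a permutation graph gives E_a(per_m) = ⟨a, 1_OF⟩ ≠ 0. Weaker
than (implied, via GIP17 Prop. 5, by) the former orbit-closure form, and exactly what `closes`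
consumes together with the proved GeneratorObstructions item PerPowTraceQP. The identity and the
per-evaluation w -/
@[route_item "route-ValiantsHypothesis-SchenstedIndex", crux]
def PowTraceCertificate : Prop :=
  ∀ m e t : ℕ, 1 ≤ m → (fun π : {π : Finpartition (Finset.univ : Finset (Fin t × Fin m × Fin m)) // ∀ B ∈ π.parts, B.card = m} => if (∀ B ∈ π.1.parts, (B.image fun s => s.2.1).card = m ∧ (B.image fun s => s.2.2).card = m) then (1 : ℂ) else 0) ∉ Submodule.span ℂ (Set.range fun X : {X : Matrix (Fin t × Fin m × Fin m) (Fin t × Fin m × Fin m) ℂ // X.rank ≤ m + e} => fun π : {π : Finpartition (Finset.univ : Finset (Fin t × Fin m × Fin m)) // ∀ B ∈ π.parts, B.card = m} => ∏ B ∈ π.1.parts, ∑ q : Fin m ≃ ↥B, ∏ i : Fin m, X.1 (q i).1 (q (finRotate m i)).1) → ∀ A : Matrix (Fin (m + e)) (Fin (m + e)) (MvPolynomial (Fin m × Fin m) ℂ), (∀ i j, (A i j).IsHomogeneous 1) → (A ^ m).trace ≠ Literature.Computability.AlgebraicComplexity.perPoly (Fin m) ℂ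

-- `PowTraceCertificate` holds: proved by `Summit.ValiantsHypothesis.ValiantsHypothesis.Theorems.SchenstedIndex.powTraceCertificate_proof` (its module imports this route file, so no `_holds` link can be stated here).

-- item stmt-ValiantsHypothesis-16108 · support · rank 4 · open · by planner — informal only, no Lean statement yet:
--   [crux] K2 of card ch-schensted-one-factorisation (DIMENSION-FORCED EQUATIONS IN PER-VISIBLE TYPES),
--   untyped at open: for every c there are, for infinitely many m and every width n ≤ 2^((log₂ m +
--   c)^c), a degree d and a partition λ ⊢ d·m with ℓ(λ) ≤ m² such that a_λ(d,m) > sm(λ,n), where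
--   a_λ(d,m) := multiplicity of the Specht module [λ] in Ind_{S_m ≀ S_d}^{S_{dm}} 1 (equivalently the
--   plethysm coefficient ⟨s_λ, h_d[h_m]⟩) and sm(λ,n) := Σ_{μ ⊢ dm, ℓ(μ) ≤ n} sk(λ,μ) with sk the
--   SYMMETRIC Kronecker coefficient (multiplicity of [λ] in Sym²[μ]); such an inequality forces (a_λ −
--   sm)₊ copies of [λ] in

-- item stmt-ValiantsHypothesis-16114 · support · rank 5 · open · by planner — informal only, no Lean statement yet:
--   [crux] K3 of card ch-schensted-one-factorisation (POSITION BEYOND MULTIPLICITY), untyped at open: in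
--   the sector w = t·J_m with slot set S (|S| = D = tm²) and in an isotypic type λ ⊢ D where the
--   dimension count of K2 does NOT force equations (a_λ(d,m) ≤ sm(λ,n)), separation at width n still
--   holds iff the λ-isotypic projection P_λ 1_{T(w)} of the indicator of the 1-FACTORISATION
--   PERMUTATIONS T(w) ⊂ S_D (permutations of cycle type (m^{tm}) whose cycles are perfect matchings of
--   t·K_{m,m}) is not contained in the range R(I_{≤ n}) of the n^cyc kernel; reduce this to character
--   sums of the conjugation

/-- item stmt-ValiantsHypothesis-16085 · support · rank 9 · closed · proved by Summit.ValiantsHypothesis.ValiantsHypothesis.Theorems.SchenstedIndex.borderPcPerThree_proof (prover) · by planner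
sources: AlperBogartVelasco2017, arXiv:1611.00827, BurgisserIkenmeyer2017
[support] special case / calibration rung (card K4): for some t the indicator 1_OF(t,3) is not in
span_3(t,3) — by SectorCertificate the border trace-power complexity of per_3 is at least 4 (known:
≥ 3 by 5-minors in sector J_3+2I; truth ≤ 7 = Grenet width via block-cyclic embedding; dc(per_3) =
7, AlperBogartVelasco2017). Certifiable by exact linear algebra per t (orbit-reduced kit job,
#SP(2·J_3) ≈ 1.9·10⁸); this session checked the encoding: n_*(J_2) = n_*(2J_2) = 2 and span_2(J_3) =
everything, span_1(J_3) ∌ 1_OF (sanity/span_check.py). [difficulty: L] -/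
@[route_item "route-ValiantsHypothesis-SchenstedIndex"]
def BorderPcPerThree : Prop :=
  ∃ t : ℕ, (fun π : {π : Finpartition (Finset.univ : Finset (Fin t × Fin 3 × Fin 3)) // ∀ B ∈ π.parts, B.card = 3} => if (∀ B ∈ π.1.parts, (B.image fun s => s.2.1).card = 3 ∧ (B.image fun s => s.2.2).card = 3) then (1 : ℂ) else 0) ∉ Submodule.span ℂ (Set.range fun X : {X : Matrix (Fin t × Fin 3 × Fin 3) (Fin t × Fin 3 × Fin 3) ℂ // X.rank ≤ 3} => fun π : {π : Finpartition (Finset.univ : Finset (Fin t × Fin 3 × Fin 3)) // ∀ B ∈ π.parts, B.card = 3} => ∏ B ∈ π.1.parts, ∑ q : Fin 3 ≃ ↥B, ∏ i : Fin 3, X.1 (q i).1 (q (finRotate 3 i)).1)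

-- `BorderPcPerThree` holds: proved by `Summit.ValiantsHypothesis.ValiantsHypothesis.Theorems.SchenstedIndex.borderPcPerThree_proof` (its module imports this route file, so no `_holds` link can be stated here).

-- earlier Assembly (stmt-ValiantsHypothesis-16086, replaced 2026-08-16T16:30:50Z -> stmt-ValiantsHypothesis-16285): retired by None — OneFactorisationBandLimit → SectorCertificate → PowTraceMembership → PerPowTraceQP → ValiantsHypothesis
-- earlier Assembly (stmt-ValiantsHypothesis-16285, replaced 2026-08-16T17:03:57Z -> stmt-ValiantsHypothesis-16008): retired by None — OneFactorisationBandLimit → SectorCertificate → ValiantsHypothesis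
/-- item stmt-ValiantsHypothesis-16008 · assembly · rank 1 · closed · proved by Summit.ValiantsHypothesis.ValiantsHypothesis.Theorems.SchenstedIndex.assembly_proof (prover) · by planner
sources: GesmundoIkenmeyerPanova2017, Valiant1979, Burgisser2000
[assembly] OneFactorisationBandLimit → PowTraceCertificate → ValiantsHypothesis — exactly the
crux-only deciding theorem `closes` (2026-08-16 cone repair): the single bookkeeping fact VP ⇒
quasi-polynomial power-trace representations is the PROVED GeneratorObstructions item
stmt-ValiantsHypothesis-11661, discharged inside the proof by Theorems.perPowTraceQP_proof, not
assumed; GIP17 Prop. 5 is no longer used. [difficulty: provable-now] -/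
@[route_item "route-ValiantsHypothesis-SchenstedIndex"]
def Assembly : Prop :=
  OneFactorisationBandLimit → PowTraceCertificate → ValiantsHypothesis

-- `Assembly` holds: proved by `Summit.ValiantsHypothesis.ValiantsHypothesis.Theorems.SchenstedIndex.assembly_proof` (its module imports this route file, so no `_holds` link can be stated here).

/-! D-0027 §2.1 — DECIDING THEOREM (planner-authored via `route open/edit --closes-file`; by planner-rrepair-ValiantsHypothesis-SchenstedIn-ed88d22b-0 2026-08-16T17:03:57Z):
its hypotheses are this route's items and its conclusion the sub-problem Statement (glue_lint), and it elaborates with this file. -/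

@[closes "route-ValiantsHypothesis-SchenstedIndex"] theorem closes (hK : OneFactorisationBandLimit) (hC : PowTraceCertificate) : _root_.ValiantsHypothesis := by
  show Literature.Computability.AlgebraicComplexity.VP ℂ ≠ Literature.Computability.AlgebraicComplexity.VNP ℂ
  intro hEq
  have hper : Literature.Computability.AlgebraicComplexity.perFamily ℂ ∈
      Literature.Computability.AlgebraicComplexity.VP ℂ := by
    rw [hEq]; exact Literature.Computability.AlgebraicComplexity.perFamily_mem_VNP_holds ℂ
  have hvp : Literature.Computability.AlgebraicComplexity.IsVPFamily
      (fun n => Literature.Computability.AlgebraicComplexity.perPoly (Fin n) ℂ) :=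
    (Literature.Computability.AlgebraicComplexity.mem_VP_ofFintype_iff_holds _).1 hper
  -- VP ⇒ quasi-polynomial power-trace representations of per_m: the PROVED item
  -- stmt-ValiantsHypothesis-11661 of route GeneratorObstructions (Theorems.perPowTraceQP_proof, clean
  -- import cone), discharged here, not assumed
  obtain ⟨c, hc⟩ :=
    Summit.ValiantsHypothesis.ValiantsHypothesis.Theorems.perPowTraceQP_proof hvp
  obtain ⟨m, -, hm1, hwin⟩ := hK c 0
  obtain ⟨e, hle, A, hA, htr⟩ := hc m hm1
  obtain ⟨t, ht⟩ := hwin e hle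
  -- the K1 witness t forbids any exact width-(m+e) power-trace representation of per_m
  exact hC m e t hm1 ht A hA htr

end Summit.ValiantsHypothesis.ValiantsHypothesis.Theses.SchenstedIndex
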